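import Mathlib
import Summits.AtomisticToContinuum.HydrodynamicLimit.Theorems.ImplosionDichotomyDenseExcursionSonicSlavingGauge

/-!
# The Levinson form and the slaved gauge of the COMPLEX characteristic system along a real path
# (crux `DenseExcursion`, line `sonic-cavity-renewal` v7, brick (M4)-(P2) for the registered stub `stub_sonicSlaving`)

Helper file (`--supports stmt-AtomisticToContinuum-12586`, line lead a2, stub-worker A (wave 3) for `stub_sonicSlaving`).

The contour-transport proof of `SonicSlaving` (worker report `work/stubs/A_sonicSlaving.REPORT.md`) transports the p-wave content
`G = e^{−θ}(P − ρ M)` of the holomorphic characteristic pair `(P, M)` (`smoothMode_wedge_continuation`) along a closed real-parameter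
loop `σ ↦ y σ` in the sonic wedge and feeds the resulting real-variable system to the Literature loop estimate
`Literature.Analysis.ODE.loop_slaving_estimate`. This file is the pointwise calculus of that pull-back, for ANY differentiable path:
with the complex coefficients `c± = Wc − 1 ± Sc`, `b₊₊, b₊₋, b₋₊, b₋₋` (as in `…SonicSlavingWedgeLocal`), a complex phase `Θ` with
`Θ′ = (Λ − b₋₋)/c₋` at the path point `z = y σ`, and the complex slaving coefficient `ρ = b₊₋/Q`, `Q = (Λ − b₊₊) − (c₊/c₋)(Λ − b₋₋)`:

* `path_levinson_form` (registered helper): `u = e^{−Θ∘y}·M∘y`, `w = e^{−Θ∘y}·P∘y` satisfy `u′ = α̃ w`, `w′ = q̃ w + β̃ u` at `σ`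
  with `α̃ = y′·(−b₋₊/c₋)`, `q̃ = y′·((Λ − b₊₊)/c₊ − (Λ − b₋₋)/c₋)`, `β̃ = y′·(−b₊₋/c₊)` (chain rule + the algebra of
  `mode_levinson_form`);
* `path_slaving_relation`: `q̃ ρ + β̃ = 0`;
* `path_slaved_gauge`: `G = w − (ρ∘y) u` satisfies `G′ = (q̃ − α̃ρ) G − (y′ρ′ + α̃ρ²) u` and `u′ = α̃ (G + ρ u)` at `σ` — exactly
  the hypotheses `hg`, `hυ` of `loop_slaving_estimate` with `a = q̃ − α̃ρ`, `f = y′ρ′ + α̃ρ²`, `α = α̃`.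

Pure pointwise calculus (no estimate, no data); `levinson_slaved_gauge` (`…SonicSlavingGauge`, abstract over `𝕜 = ℝ`) does the gauge
step. No citation is load-bearing.
-/

noncomputable section

open Set

namespace Summit.AtomisticToContinuum.HydrodynamicLimit.Theorems.SonicCavityRenewal

open Summit.AtomisticToContinuum.HydrodynamicLimit.Theorems.R2OneModeTwoConditions

/-- Chain rule for a complex function along a real path, scalar case: `(F ∘ y)′(σ) = y′ · F′(y σ)`. [folklore] -/
theorem hasDerivAt_comp_realPath {F : ℂ → ℂ} {F' : ℂ} {y : ℝ → ℂ} {y' : ℂ} {σ : ℝ} (hF : HasDerivAt F F' (y σ))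
    (hy : HasDerivAt y y' σ) : HasDerivAt (fun s => F (y s)) (y' * F') σ := by
  have h := hF.comp σ hy
  rw [mul_comm] at h
  exact h

/-- **THE LEVINSON FORM OF THE COMPLEX CHARACTERISTIC SYSTEM ALONG A REAL PATH** — registered helper `path_levinson_form` for
`stub_sonicSlaving`. At a parameter `σ` where the path `y` has derivative `y′`, the pair `(P, M)` is complex-differentiable at
`z = y σ` and satisfies the complex characteristic system there with `c₊(z) c₋(z) ≠ 0`, and `Θ` has complex derivative
`(Λ − b₋₋(z))/c₋(z)` at `z`: the amplitudes `u = e^{−Θ(y s)} M(y s)`, `w = e^{−Θ(y s)} P(y s)` satisfy `u′ = α̃ w`,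
`w′ = q̃ w + β̃ u` at `σ` with `α̃ = y′(−b₋₊/c₋)(z)`, `q̃ = y′((Λ − b₊₊)/c₊ − (Λ − b₋₋)/c₋)(z)`, `β̃ = y′(−b₊₋/c₊)(z)`. [folklore] -/
theorem path_levinson_form : ∀ (r : ℝ) (Wc Sc P M Θ : ℂ → ℂ) (Λ : ℂ) (y : ℝ → ℂ) (y' : ℂ) (σ : ℝ), HasDerivAt y y' σ → DifferentiableAt ℂ P (y σ) → DifferentiableAt ℂ M (y σ) → (Wc (y σ) - 1 + Sc (y σ)) * deriv P (y σ) = (Λ - (2 / 3 * deriv Wc (y σ) + 2 * Wc (y σ) - r + 2 * deriv Sc (y σ) + 4 * Sc (y σ))) * P (y σ) - (deriv Wc (y σ) / 3 + deriv Sc (y σ) + 2 * Sc (y σ)) * M (y σ) → (Wc (y σ) - 1 - Sc (y σ)) * deriv M (y σ) = -(deriv Wc (y σ) / 3 - deriv Sc (y σ) - 2 * Sc (y σ)) * P (y σ) + (Λ - (2 / 3 * deriv Wc (y σ) + 2 * Wc (y σ) - r - 2 * deriv Sc (y σ) - 4 * Sc (y σ))) * M (y σ) → Wc (y σ) - 1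 + Sc (y σ) ≠ 0 → Wc (y σ) - 1 - Sc (y σ) ≠ 0 → HasDerivAt Θ ((Λ - (2 / 3 * deriv Wc (y σ) + 2 * Wc (y σ) - r - 2 * deriv Sc (y σ) - 4 * Sc (y σ))) / (Wc (y σ) - 1 - Sc (y σ))) (y σ) → HasDerivAt (fun s => Complex.exp (-Θ (y s)) * M (y s)) (y' * (-(deriv Wc (y σ) / 3 - deriv Sc (y σ) - 2 * Sc (y σ)) / (Wc (y σ) - 1 - Sc (y σ))) * (Complex.exp (-Θ (y σ)) * P (y σ))) σ ∧ HasDerivAt (fun s => Complex.exp (-Θ (y s)) * P (y s)) (y' * ((Λ - (2 / 3 * deriv Wc (y σ) + 2 * Wc (y σ) - r + 2 * deriv Sc (y σ) + 4 * Sc (y σ))) / (Wc (y σ) - 1 + Sc (y σ)) - (Λ - (2 / 3 * deriv Wc (y σ) + 2 * Wc (y σ) - r - 2 * deriv Sc (y σ) - 4 * Sc (y σ))) / (Wc (y σ) - 1 - Sc (y σ))) * (Complex.exp (-Θ (y σ)) * P (y σ)) + y' * (-(deriv Wc (y σ) / 3 + deriv Sc (y σ) + 2 * Sc (y σ)) /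 (Wc (y σ) - 1 + Sc (y σ))) * (Complex.exp (-Θ (y σ)) * M (y σ))) σ := by
  intro r Wc Sc P M Θ Λ y y' σ hy hP hM h1 h2 hcp hcm hΘ
  -- derivatives along the path
  have dM : HasDerivAt (fun s => M (y s)) (y' * deriv M (y σ)) σ := hasDerivAt_comp_realPath hM.hasDerivAt hy
  have dP : HasDerivAt (fun s => P (y s)) (y' * deriv P (y σ)) σ := hasDerivAt_comp_realPath hP.hasDerivAt hy
  have dΘ := hasDerivAt_comp_realPath hΘ hy
  have dE : HasDerivAt (fun s => Complex.exp (-Θ (y s)))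
      (Complex.exp (-Θ (y σ)) * -(y' * ((Λ - (2 / 3 * deriv Wc (y σ) + 2 * Wc (y σ) - r - 2 * deriv Sc (y σ) - 4 * Sc (y σ))) /
        (Wc (y σ) - 1 - Sc (y σ))))) σ := dΘ.neg.cexp
  -- solved derivatives
  have aux : ∀ (c' X d : ℂ), c' ≠ 0 → c' * d = X → d = X / c' := fun c' X d hc' h => by
    rw [eq_div_iff hc']; linear_combination h
  have eM := aux _ _ _ hcm h2
  have eP := aux _ _ _ hcp h1
  have icm : (Wc (y σ) - 1 - Sc (y σ)) * (Wc (y σ) - 1 - Sc (y σ))⁻¹ = 1 := mul_inv_cancel₀ hcm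
  have icp : (Wc (y σ) - 1 + Sc (y σ)) * (Wc (y σ) - 1 + Sc (y σ))⁻¹ = 1 := mul_inv_cancel₀ hcp
  constructor
  · refine (dE.mul dM).congr_deriv ?_
    rw [eM]
    field_simp
    ring
  · refine (dE.mul dP).congr_deriv ?_
    rw [eP]
    field_simp
    ring

/-- **The slaving relation** `q̃ ρ + β̃ = 0` for the complex coefficients: `ρ = b₊₋/Q`, `Q = (Λ − b₊₊) − (c₊/c₋)(Λ − b₋₋) = c₊ q`,
`β = −b₊₋/c₊`, wherever `c₊ c₋ Q ≠ 0`. [folklore] -/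
theorem path_slaving_relation {r : ℝ} {Wc Sc : ℂ → ℂ} {Λ y' z : ℂ} (hcp : Wc z - 1 + Sc z ≠ 0) (hcm : Wc z - 1 - Sc z ≠ 0)
    (hQ : (Λ - (2 / 3 * deriv Wc z + 2 * Wc z - r + 2 * deriv Sc z + 4 * Sc z)) -
      (Wc z - 1 + Sc z) / (Wc z - 1 - Sc z) * (Λ - (2 / 3 * deriv Wc z + 2 * Wc z - r - 2 * deriv Sc z - 4 * Sc z)) ≠ 0) :
    y' * ((Λ - (2 / 3 * deriv Wc z + 2 * Wc z - r + 2 * deriv Sc z + 4 * Sc z)) / (Wc z - 1 + Sc z) -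
        (Λ - (2 / 3 * deriv Wc z + 2 * Wc z - r - 2 * deriv Sc z - 4 * Sc z)) / (Wc z - 1 - Sc z)) *
      ((deriv Wc z / 3 + deriv Sc z + 2 * Sc z) /
        ((Λ - (2 / 3 * deriv Wc z + 2 * Wc z - r + 2 * deriv Sc z + 4 * Sc z)) -
          (Wc z - 1 + Sc z) / (Wc z - 1 - Sc z) * (Λ - (2 / 3 * deriv Wc z + 2 * Wc z - r - 2 * deriv Sc z - 4 * Sc z)))) +
      y' * (-(deriv Wc z / 3 + deriv Sc z + 2 * Sc z) / (Wc z - 1 + Sc z)) = 0 := by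
  have hq : (Λ - (2 / 3 * deriv Wc z + 2 * Wc z - r + 2 * deriv Sc z + 4 * Sc z)) / (Wc z - 1 + Sc z) -
      (Λ - (2 / 3 * deriv Wc z + 2 * Wc z - r - 2 * deriv Sc z - 4 * Sc z)) / (Wc z - 1 - Sc z) =
      ((Λ - (2 / 3 * deriv Wc z + 2 * Wc z - r + 2 * deriv Sc z + 4 * Sc z)) -
        (Wc z - 1 + Sc z) / (Wc z - 1 - Sc z) * (Λ - (2 / 3 * deriv Wc z + 2 * Wc z - r - 2 * deriv Sc z - 4 * Sc z))) /
        (Wc z - 1 + Sc z) := by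
    field_simp
  have key : ∀ (Q' c b w : ℂ), Q' ≠ 0 → w * (Q' / c) * (b / Q') + w * (-b / c) = 0 := by
    intro Q' c b w hQ'
    rw [mul_assoc, div_mul_div_comm, mul_comm Q' b, ← div_mul_div_comm, div_self hQ', mul_one, neg_div]
    ring
  rw [hq]
  exact key _ _ _ _ hQ

/-- **THE SLAVED GAUGE ALONG A REAL PATH.** Under the hypotheses of `path_levinson_form`, with moreover `Q(z) ≠ 0` and the complex
slaving coefficient `ρ = b₊₋/Q` complex-differentiable at `z = y σ` with derivative `ρ′`, the gauged p-wave content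
`G(s) = e^{−Θ(y s)}(P(y s) − ρ(y s) M(y s))` and `u(s) = e^{−Θ(y s)} M(y s)` satisfy at `σ`
  `G′ = (q̃ − α̃ ρ) G − (y′ρ′ + α̃ ρ²) u`,   `u′ = α̃ (G + ρ u)`
— the hypotheses `hg`, `hυ` of `Literature.Analysis.ODE.loop_slaving_estimate` (`a = q̃ − α̃ρ`, `f = y′ρ′ + α̃ρ²`, `α = α̃`).
[folklore] -/
theorem path_slaved_gauge : ∀ (r : ℝ) (Wc Sc P M Θ : ℂ → ℂ) (Λ : ℂ) (y : ℝ → ℂ) (y' ρ' : ℂ) (σ : ℝ), HasDerivAt y y' σ → DifferentiableAt ℂ P (y σ) → DifferentiableAt ℂ M (y σ) → (Wc (y σ) - 1 + Sc (y σ)) * deriv P (y σ) = (Λ - (2 / 3 * deriv Wc (y σ) + 2 * Wc (y σ) - r + 2 * deriv Sc (y σ) + 4 * Sc (y σ))) * P (y σ) - (deriv Wc (y σ) / 3 + deriv Sc (y σ) + 2 * Sc (y σ)) * M (y σ) → (Wc (y σ) - 1 - Sc (y σ)) * deriv M (y σ) = -(deriv Wc (y σ) / 3 - deriv Sc (y σ)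 - 2 * Sc (y σ)) * P (y σ) + (Λ - (2 / 3 * deriv Wc (y σ) + 2 * Wc (y σ) - r - 2 * deriv Sc (y σ) - 4 * Sc (y σ))) * M (y σ) → Wc (y σ) - 1 + Sc (y σ) ≠ 0 → Wc (y σ) - 1 - Sc (y σ) ≠ 0 → (Λ - (2 / 3 * deriv Wc (y σ) + 2 * Wc (y σ) - r + 2 * deriv Sc (y σ) + 4 * Sc (y σ))) - (Wc (y σ) - 1 + Sc (y σ)) / (Wc (y σ) - 1 - Sc (y σ)) * (Λ - (2 / 3 * deriv Wc (y σ) + 2 * Wc (y σ) - r - 2 * deriv Sc (y σ) - 4 * Sc (y σ))) ≠ 0 → HasDerivAt Θ ((Λ - (2 / 3 * deriv Wc (y σ) + 2 * Wc (y σ) - r - 2 * deriv Sc (y σ) - 4 * Sc (y σ))) / (Wc (y σ) - 1 - Sc (y σ))) (y σ) → HasDerivAt (fun z => (deriv Wc z / 3 + deriv Sc z + 2 * Sc z) / ((Λ - (2 / 3 * deriv Wc z + 2 * Wc z - r + 2 * deriv Sc z + 4 * Sc z)) - (Wc z - 1 + Sc z) / (Wc z - 1 - Sc z) * (Λ - (2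 / 3 * deriv Wc z + 2 * Wc z - r - 2 * deriv Sc z - 4 * Sc z)))) ρ' (y σ) → HasDerivAt (fun s => Complex.exp (-Θ (y s)) * (P (y s) - (deriv Wc (y s) / 3 + deriv Sc (y s) + 2 * Sc (y s)) / ((Λ - (2 / 3 * deriv Wc (y s) + 2 * Wc (y s) - r + 2 * deriv Sc (y s) + 4 * Sc (y s))) - (Wc (y s) - 1 + Sc (y s)) / (Wc (y s) - 1 - Sc (y s)) * (Λ - (2 / 3 * deriv Wc (y s) + 2 * Wc (y s) - r - 2 * deriv Sc (y s) - 4 * Sc (y s)))) * M (y s))) ((y' * ((Λ - (2 / 3 * deriv Wc (y σ) + 2 * Wc (y σ) - r + 2 * deriv Sc (y σ) + 4 * Sc (y σ))) / (Wc (y σ) - 1 + Sc (y σ)) - (Λ - (2 / 3 * deriv Wc (y σ) + 2 * Wc (y σ) - r - 2 * deriv Sc (y σ) - 4 * Sc (y σ))) / (Wc (y σ) - 1 - Sc (y σ))) - y' * (-(deriv Wc (y σ) / 3 - deriv Sc (y σ) - 2 * Sc (y σ)) / (Wc (y σ) - 1 - Sc (y σ))) * ((deriv Wc (y σ) / 3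 + deriv Sc (y σ) + 2 * Sc (y σ)) / ((Λ - (2 / 3 * deriv Wc (y σ) + 2 * Wc (y σ) - r + 2 * deriv Sc (y σ) + 4 * Sc (y σ))) - (Wc (y σ) - 1 + Sc (y σ)) / (Wc (y σ) - 1 - Sc (y σ)) * (Λ - (2 / 3 * deriv Wc (y σ) + 2 * Wc (y σ) - r - 2 * deriv Sc (y σ) - 4 * Sc (y σ)))))) * (Complex.exp (-Θ (y σ)) * (P (y σ) - (deriv Wc (y σ) / 3 + deriv Sc (y σ) + 2 * Sc (y σ)) / ((Λ - (2 / 3 * deriv Wc (y σ) + 2 * Wc (y σ) - r + 2 * deriv Sc (y σ) + 4 * Sc (y σ))) - (Wc (y σ) - 1 + Sc (y σ)) / (Wc (y σ) - 1 - Sc (y σ)) * (Λ - (2 / 3 * deriv Wc (y σ) + 2 * Wc (y σ) - r - 2 * deriv Sc (y σ) - 4 * Sc (y σ)))) * M (y σ))) - (y' * ρ' + y' * (-(deriv Wc (y σ) / 3 - deriv Sc (y σ) - 2 * Sc (y σ)) / (Wc (y σ) - 1 - Sc (y σ))) * ((deriv Wc (y σ) / 3 + deriv Sc (y σ) + 2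 * Sc (y σ)) / ((Λ - (2 / 3 * deriv Wc (y σ) + 2 * Wc (y σ) - r + 2 * deriv Sc (y σ) + 4 * Sc (y σ))) - (Wc (y σ) - 1 + Sc (y σ)) / (Wc (y σ) - 1 - Sc (y σ)) * (Λ - (2 / 3 * deriv Wc (y σ) + 2 * Wc (y σ) - r - 2 * deriv Sc (y σ) - 4 * Sc (y σ))))) ^ 2) * (Complex.exp (-Θ (y σ)) * M (y σ))) σ ∧ HasDerivAt (fun s => Complex.exp (-Θ (y s)) * M (y s)) (y' * (-(deriv Wc (y σ) / 3 - deriv Sc (y σ) - 2 * Sc (y σ)) / (Wc (y σ) - 1 - Sc (y σ))) * (Complex.exp (-Θ (y σ)) * (P (y σ) - (deriv Wc (y σ) / 3 + deriv Sc (y σ) + 2 * Sc (y σ)) / ((Λ - (2 / 3 * deriv Wc (y σ) + 2 * Wc (y σ) - r + 2 * deriv Sc (y σ) + 4 * Sc (y σ))) - (Wc (y σ) - 1 + Sc (y σ)) / (Wc (y σ) - 1 - Sc (y σ)) * (Λ - (2 / 3 * deriv Wc (y σ) + 2 * Wc (y σ) - r - 2 * deriv Sc (y σ) - 4 * Sc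 (y σ)))) * M (y σ)) + (deriv Wc (y σ) / 3 + deriv Sc (y σ) + 2 * Sc (y σ)) / ((Λ - (2 / 3 * deriv Wc (y σ) + 2 * Wc (y σ) - r + 2 * deriv Sc (y σ) + 4 * Sc (y σ))) - (Wc (y σ) - 1 + Sc (y σ)) / (Wc (y σ) - 1 - Sc (y σ)) * (Λ - (2 / 3 * deriv Wc (y σ) + 2 * Wc (y σ) - r - 2 * deriv Sc (y σ) - 4 * Sc (y σ)))) * (Complex.exp (-Θ (y σ)) * M (y σ)))) σ := by
  intro r Wc Sc P M Θ Λ y y' ρ' σ hy hP hM h1 h2 hcp hcm hQ hΘ hρ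
  obtain ⟨hu, hw⟩ := path_levinson_form r Wc Sc P M Θ Λ y y' σ hy hP hM h1 h2 hcp hcm hΘ
  -- the slaving coefficient along the path
  have hρy := hasDerivAt_comp_realPath hρ hy
  have hslave := path_slaving_relation (r := r) (Wc := Wc) (Sc := Sc) (Λ := Λ) (y' := y') (z := y σ) hcp hcm hQ
  have key := levinson_slaved_gauge (𝕜 := ℝ) (u := fun s => Complex.exp (-Θ (y s)) * M (y s))
    (w := fun s => Complex.exp (-Θ (y s)) * P (y s))
    (ρ := fun s => (deriv Wc (y s) / 3 + deriv Sc (y s) + 2 * Sc (y s)) /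
      ((Λ - (2 / 3 * deriv Wc (y s) + 2 * Wc (y s) - r + 2 * deriv Sc (y s) + 4 * Sc (y s))) -
        (Wc (y s) - 1 + Sc (y s)) / (Wc (y s) - 1 - Sc (y s)) * (Λ - (2 / 3 * deriv Wc (y s) + 2 * Wc (y s) - r - 2 * deriv Sc (y s) - 4 * Sc (y s)))))
    (x := σ) hu hw hρy hslave
  constructor
  · have hfun : (fun s => Complex.exp (-Θ (y s)) * (P (y s) - (deriv Wc (y s) / 3 + deriv Sc (y s) + 2 * Sc (y s)) /
        ((Λ - (2 / 3 * deriv Wc (y s) + 2 * Wc (y s) - r + 2 * deriv Sc (y s) + 4 * Sc (y s))) -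
          (Wc (y s) - 1 + Sc (y s)) / (Wc (y s) - 1 - Sc (y s)) * (Λ - (2 / 3 * deriv Wc (y s) + 2 * Wc (y s) - r - 2 * deriv Sc (y s) - 4 * Sc (y s)))) * M (y s))) =
        fun s => Complex.exp (-Θ (y s)) * P (y s) - (deriv Wc (y s) / 3 + deriv Sc (y s) + 2 * Sc (y s)) /
          ((Λ - (2 / 3 * deriv Wc (y s) + 2 * Wc (y s) - r + 2 * deriv Sc (y s) + 4 * Sc (y s))) -
            (Wc (y s) - 1 + Sc (y s)) / (Wc (y s) - 1 - Sc (y s)) * (Λ - (2 / 3 * deriv Wc (y s) + 2 * Wc (y s) - r - 2 * deriv Sc (y s) - 4 * Sc (y s)))) *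
          (Complex.exp (-Θ (y s)) * M (y s)) := funext fun s => by ring
    rw [hfun]
    refine key.congr_deriv ?_
    ring
  · refine hu.congr_deriv ?_
    ring

end Summit.AtomisticToContinuum.HydrodynamicLimit.Theorems.SonicCavityRenewal

end
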